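import Mathlib
import Literature.NumberTheory.LFunctions.Zhang2022.Section15ExactGammaWeight
import Literature.NumberTheory.LFunctions.Zhang2022.Section17ReflectionStep
import HarnessLib

/-!
# Zhang (2022), §17 p. 97: the EXACT `ψ`-independent gamma weight of the reflected integrand `𝔨₃(s,ψ)`
# (`𝔨₃ = W₃·𝔨₃*` exactly, `W₃ = (pt₀)^{−β₁}(1 + O(𝓛⁻¹²³))` on Lemma 5.1's range), kernel-checked

Topic `Literature/NumberTheory/LFunctions/Zhang2022` (Landau–Siegel audit tree; verdict-neutral).
Y. Zhang, *Discrete mean estimates and the Landau–Siegel zero*, arXiv:2211.02515v1 (2022)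
[Zhang2022LandauSiegel] — **an unrefereed manuscript under adjudication; nothing here asserts or denies
its Theorems 1–2.** Lane ZHANG-L, the (17.7)–(17.9) chain (`§17.u010–u013`) under the leaf
`Typed.Section17.Eq17_9Rel`. The §17 twin of `Section15ExactGammaWeight`.

§17 p. 97 (tex L4770–L4789): "To treat the sum involving `I₄⁻(ψ)` on `𝔍(−α)` we first apply Lemma 5.1
to obtain `L(s+β₁,ψ)/L(s,ψ) = (pt₀)^{−β₁}(L(1−s−β₁,ψ̄)/L(1−s,ψ̄))(1 + O(α⁶))` […] Thus […]
`Σ_{ψ∈Ψ₁}(p_ψt₀)^{β₃}I₄⁻(ψ) = Σ_{ψ∈Ψ₁}(p_ψt₀)^{β₂}·(1/2πi)∫_{𝔍(−α)} 𝔨₃*(s,ψ)ω(s)ds + o(𝔓)` where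
`𝔨₃*(s,ψ) = (L(1−s−β₁,ψ̄)/L(1−s,ψ̄))F(1−s,ψ̄)B(s,ψ)G(s,ψ)N(s+β₂,ψ)N(s+β₃,ψ)`." The pointwise step
(`Typed.Section17.Step17_u010`) is the tree theorem `step17_u010_holds` (`Section17ReflectionStep`).
This file records the EXACT form of the reflection, with no `O`-term:

* `gammaWeight17 c′ D p eψ s` — **`W₃ = p^{−β₁}·ϑ(s+β₁)/ϑ(s)·(1+c_{eψ}(s+β₁))/(1+c_{eψ}(s))`**
  (`c_e = GammaFactor.corrSign e`, the (2.4)-correction indexed by the sign `e = ψ(−1)`): a function of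
  `s` and of the data `(p, ψ(−1))` only — NOT of `ψ`;
* `Zfac_shift_div_eq_gammaWeight17` — `Z(s+β₁,ψ)/Z(s,ψ) = W₃` EXACTLY for `ψ ∈ Ψ`, `Im s, Im(s+β₁) > 0`
  (the exact (2.4) `GammaFactor.Zfac_eq` at `s` and `s+β₁`);
* `kfrak3_eq_gammaWeight17_mul` — for every `c′`, all large `D`, every `ψ ∈ Ψ`, `Im s ≥ 2`:
  **`𝔨₃(s,ψ) = W₃(p,ψ(−1),s)·𝔨₃*(s,ψ)` EXACTLY** (`Typed.Section17.kfrak3`, `kfrak3Star`), from the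
  functional equation (2.2) (`GammaFactor.LFunction_eq_Zfac_mul`) at `s`, `s+β₁` — no condition on `Re s`;
* `norm_gammaWeight17_sub_le` — **`|W₃ − (pt₀)^{−β₁}| ≤ A·𝓛⁻¹²³`** on Lemma 5.1's range
  (`|Re s − ½| ≤ α`, `|Im s − 2πt₀| < 𝓛₁ + 2`; in particular on `𝔍(−α)`), for all large `D`, from the
  tree's relative Lemma 5.1 `Skeleton.exists_Zfac_shift_rel` (`|(pt₀)^{−β₁}| = 1`).

Why (analysis note, not a claim): the printed `o(𝔓)` of u011 multiplies the relative error by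
`Σ_{Ψ₁}∫_{𝔍(−α)}|𝔨₃*ω|`, a mean value whose crude divisor-power count is within a hair of the
`𝓛¹²³` budget; keeping `W₃` exact through (17.7)–(17.8) (orthogonality by parity classes `ψ(−1) = ±1`,
under which `W₃` is constant in `ψ`) and approximating it only on the diagonal terms, where absolute
summation is harmless, avoids the issue. One new OBJECT definition (`gammaWeight17`); no `Prop` is
defined, no named fact; axioms standard. Nothing about (17.7)–(17.10), Theorems 1–2 or Landau–Siegel
zeros is asserted.

## References

* Y. Zhang, arXiv:2211.02515v1 (2022), §17 p. 97 (tex L4770–L4789); §2 (2.2)–(2.4) p. 4; §5 Lemma 5.1.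
  [cite: Zhang2022LandauSiegel, §17 p. 97; §2 (2.2)–(2.4)]
* H. L. Montgomery, R. C. Vaughan, *Multiplicative Number Theory I* (CUP 2007), Cor 10.9.
  [cite: MontgomeryVaughan2007, Cor 10.9]
-/

noncomputable section

open Complex Real ComplexConjugate

namespace Literature.NumberTheory.LFunctions.Zhang2022.Typed.Section17

open Literature.NumberTheory.LFunctions.Zhang2022
open Literature.NumberTheory.LFunctions.Zhang2022.Skeleton
open Literature.NumberTheory.LFunctions.Zhang2022.GammaFactor

/-- **The exact gamma weight `W₃` of the reflected `𝔨₃`** (§17 p. 97, the main term `(pt₀)^{−β₁}` and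
the `(1 + O(·))` of u010 made exact): `W₃ = p^{−β₁}·ϑ(s+β₁)/ϑ(s)·(1+c_{eψ}(s+β₁))/(1+c_{eψ}(s))`,
`c_e = GammaFactor.corrSign e`, for the data `p` (modulus of `ψ`) and `eψ = ψ(−1)`; it depends on `ψ`
only through `p` and `ψ(−1)`. [cite: Zhang2022LandauSiegel, §17 p. 97] -/
def gammaWeight17 (c' : ℝ) (D p : ℕ) (eψ : ℂ) (s : ℂ) : ℂ :=
  (p : ℂ) ^ (-beta1 c' D) * (vartheta (s + beta1 c' D) / vartheta s) *
    ((1 + corrSign eψ (s + beta1 c' D)) / (1 + corrSign eψ s))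

section Identity

variable (c' : ℝ) {D : ℕ} (x : Chr D)

/-- **`Z(s+β₁,ψ)/Z(s,ψ) = W₃` EXACTLY** for `ψ ∈ Ψ` and `Im s, Im(s+β₁) > 0` (the exact (2.4)
`GammaFactor.Zfac_eq` at `s` and `s+β₁`; `ψ(−1)`, `τ(ψ)`, `p^{−s}`, `ϑ(s)`, `1 + c(s)` cancel or do not
vanish). [cite: Zhang2022LandauSiegel, §17 p. 97; §2 (2.4)] -/
theorem Zfac_shift_div_eq_gammaWeight17 {s : ℂ} (hs : 0 < s.im) (hs1 : 0 < (s + beta1 c' D).im) :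
    Zfac x.ψ (s + beta1 c' D) / Zfac x.ψ s = gammaWeight17 c' D x.p (x.ψ (-1)) s := by
  have hp0 : (x.p : ℂ) ≠ 0 := Nat.cast_ne_zero.mpr x.prime.ne_zero
  have hZ0 := Zfac_eq x.ψ hs
  have hZ1 := Zfac_eq x.ψ hs1
  have hc0 : corr x.ψ s = corrSign (x.ψ (-1)) s := corr_eq_corrSign x.ψ s
  have hc1 : corr x.ψ (s + beta1 c' D) = corrSign (x.ψ (-1)) (s + beta1 c' D) := corr_eq_corrSign x.ψ _
  have hpp : (x.p : ℂ) ^ (-(s + beta1 c' D)) = (x.p : ℂ) ^ (-s) * (x.p : ℂ) ^ (-beta1 c' D) := by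
    rw [← Complex.cpow_add _ _ hp0]; congr 1; ring
  -- non-vanishing of the denominator's factors
  have hτ : tau x.ψ ≠ 0 := tau_ne_zero x.prim
  have he : x.ψ (-1) ≠ 0 := fun h => by
    have hee : x.ψ (-1) * x.ψ (-1) = 1 := by rw [← map_mul, neg_mul_neg, one_mul, map_one]
    rw [h, zero_mul] at hee; exact zero_ne_one hee
  have hP0 : (x.p : ℂ) ^ (-s) ≠ 0 := by
    rw [Ne, Complex.cpow_eq_zero_iff, not_and_or]; exact Or.inl hp0
  have hϑ : vartheta s ≠ 0 := vartheta_ne_zero (ChiStirling.sin_pi_mul_ne_zero hs.ne')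
  have hd0 : 1 + corrSign (x.ψ (-1)) s ≠ 0 := one_add_corrSign_ne_zero x.ψ hs
  have hZne : Zfac x.ψ s ≠ 0 := Zfac_ne_zero x.prim hs
  rw [div_eq_iff hZne, hZ1, hZ0, hc0, hc1, hpp, gammaWeight17]
  field_simp

/-- `L₀ ≤ log D` once `D ≥ ⌈exp L₀⌉₊`. [folklore] -/
private theorem le_ell_of_ceil_exp_le_W17 {L₀ : ℝ} {D : ℕ} (hD : ⌈Real.exp L₀⌉₊ ≤ D) :
    L₀ ≤ ell D := by
  have h : Real.exp L₀ ≤ D := le_trans (Nat.le_ceil _) (by exact_mod_cast hD)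
  exact (Real.le_log_iff_exp_le (lt_of_lt_of_le (Real.exp_pos _) h)).mpr h

/-- **The reflected integrand of §17, EXACTLY**: for every `c′`, for all large `D` (real primitive
`χ (mod D)`), every `ψ ∈ Ψ` and every `s` with `Im s ≥ 2`:
`𝔨₃(s,ψ) = W₃(p,ψ(−1),s)·𝔨₃*(s,ψ)` — the functional equation (2.2) at `s` and `s+β₁`
(`GammaFactor.LFunction_eq_Zfac_mul`: `L(s+β₁,ψ)/L(s,ψ) = (Z(s+β₁,ψ)/Z(s,ψ))·(L(1−s−β₁,ψ̄)/L(1−s,ψ̄))`,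
divisions included) and `Zfac_shift_div_eq_gammaWeight17`. (For `D` large `|β₁| ≤ 1`, so
`Im(s+β₁) > 0`.) No hypothesis on `Re s`. [cite: Zhang2022LandauSiegel, §17 p. 97] -/
theorem kfrak3_eq_gammaWeight17_mul :
    ForAllLarge fun D _ χ => ∀ x : Chr D, ∀ s : ℂ, 2 ≤ s.im →
      kfrak3 c' χ x s = gammaWeight17 c' D x.p (x.ψ (-1)) s * kfrak3Star c' χ x s := by
  refine ForAllLarge.of_le (max 3 ⌈Real.exp (π * |c'| + 3)⌉₊) fun D _ χ hD _ _ x s him => ?_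
  have hD3 : 3 ≤ D := le_trans (le_max_left _ _) hD
  have hℓc : π * |c'| + 3 ≤ ell D := le_ell_of_ceil_exp_le_W17 (le_trans (le_max_right _ _) hD)
  have hℓ3 : 3 ≤ ell D := by nlinarith [Real.pi_pos, abs_nonneg c']
  have hℓ1 : 1 ≤ ell D := by linarith
  obtain ⟨hα0, hα6, -⟩ := Step8u016.alpha_small hℓ3
  have hc8 : π * |c'| ≤ ell D ^ 8 := by
    have : ell D ≤ ell D ^ 8 := by
      calc ell D = ell D ^ 1 := (pow_one _).symm
        _ ≤ ell D ^ 8 := pow_le_pow_right₀ hℓ1 (by norm_num)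
    linarith
  have hcα := Step8u016.abs_c_mul_alpha_ell_le_one (c' := c') hℓ3 hc8
  obtain ⟨hb1, -, -⟩ := Step8u016.abs_b_le_one c' hα0.le hα6 hcα
  obtain ⟨e1, -, -⟩ := Section8aStatements.beta_eq_b_mul_I c' D
  have hs0 : 0 < s.im := by linarith
  have hs1 : 0 < (s + beta1 c' D).im := by
    rw [e1]; simp; linarith [(abs_le.mp hb1).1]
  have hFE0 : x.ψ.LFunction s = Zfac x.ψ s * x.ψ⁻¹.LFunction (1 - s) :=
    LFunction_eq_Zfac_mul x.prim x.p_ne_one hs0.ne'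
  have hFE1 : x.ψ.LFunction (s + beta1 c' D) =
      Zfac x.ψ (s + beta1 c' D) * x.ψ⁻¹.LFunction (1 - s - beta1 c' D) := by
    rw [LFunction_eq_Zfac_mul x.prim x.p_ne_one hs1.ne',
      show (1 : ℂ) - (s + beta1 c' D) = 1 - s - beta1 c' D by ring]
  have hW := Zfac_shift_div_eq_gammaWeight17 c' x hs0 hs1
  calc kfrak3 c' χ x s
      = x.ψ.LFunction (s + beta1 c' D) / x.ψ.LFunction s * Bpoly χ x s * Gpoly χ x s *
          Nchar D (psiFn x) (s + beta2 c' D) * Nchar D (psiFn x) (s + beta3 c' D) *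
          FpolyBar χ x (1 - s) := rfl
    _ = Zfac x.ψ (s + beta1 c' D) / Zfac x.ψ s *
          (x.ψ⁻¹.LFunction (1 - s - beta1 c' D) / x.ψ⁻¹.LFunction (1 - s)) * Bpoly χ x s *
          Gpoly χ x s * Nchar D (psiFn x) (s + beta2 c' D) * Nchar D (psiFn x) (s + beta3 c' D) *
          FpolyBar χ x (1 - s) := by
        rw [hFE1, hFE0, mul_div_mul_comm]
    _ = gammaWeight17 c' D x.p (x.ψ (-1)) s * kfrak3Star c' χ x s := by
        rw [hW, kfrak3Star]; ring

end Identity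

section Size

variable (c' : ℝ)

/-- `L₀ ≤ log D` once `D ≥ ⌈exp L₀⌉₊`. [folklore] -/
private theorem le_ell_of_ceil_exp_le_W17' {L₀ : ℝ} {D : ℕ} (hD : ⌈Real.exp L₀⌉₊ ≤ D) :
    L₀ ≤ ell D := by
  have h : Real.exp L₀ ≤ D := le_trans (Nat.le_ceil _) (by exact_mod_cast hD)
  exact (Real.le_log_iff_exp_le (lt_of_lt_of_le (Real.exp_pos _) h)).mpr h

/-- **`W₃ = (pt₀)^{−β₁}(1 + O(𝓛⁻¹²³))` on Lemma 5.1's range**: for every `c′` there is `A ≥ 0` with,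
for all large `D`, every `ψ ∈ Ψ` and every `s` with `|Re s − ½| ≤ α`, `|Im s − 2πt₀| < 𝓛₁ + 2`
(in particular on `𝔍(−α)`): `‖W₃(p,ψ(−1),s) − (pt₀)^{−β₁}‖ ≤ A·𝓛⁻¹²³` — the relative Lemma 5.1 of
the tree (`Skeleton.exists_Zfac_shift_rel` at `b = b₁`, `|b₁| ≤ 2(1+5|c′|)α`) and
`Zfac_shift_div_eq_gammaWeight17`, with `|(pt₀)^{−β₁}| = 1`. [cite: Zhang2022LandauSiegel, §17 p. 97] -/
theorem norm_gammaWeight17_sub_le :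
    ∃ A : ℝ, 0 ≤ A ∧ ForAllLarge fun D _ _ => ∀ x : Chr D, ∀ s : ℂ, InRange51 D s →
      ‖gammaWeight17 c' D x.p (x.ψ (-1)) s - (((x.p : ℝ) * t0 D : ℝ) : ℂ) ^ (-beta1 c' D)‖ ≤
        A * (ell D ^ 123)⁻¹ := by
  set K : ℝ := 2 * (1 + 5 * |c'|) with hK
  have hK0 : 0 ≤ K := by rw [hK]; positivity
  obtain ⟨A, hA0, D₁, h⟩ := exists_Zfac_shift_rel hK0
  refine ⟨A, hA0, ForAllLarge.of_le (max D₁ ⌈Real.exp (K * π + 4)⌉₊)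
    fun D _ χ hD hq hχ x s hs => ?_⟩
  have hD₁ : D₁ ≤ D := le_trans (le_max_left _ _) hD
  have hLK : K * π + 4 ≤ ell D := le_ell_of_ceil_exp_le_W17' (le_trans (le_max_right _ _) hD)
  have hKπ : 0 ≤ K * π := by positivity
  have hL2 : 2 ≤ ell D := by linarith
  have hL1 : 1 ≤ ell D := by linarith
  have hL0 : 0 < ell D := by linarith
  have hα : 0 < alpha D := alpha_pos' hL0
  have hαeq : alpha D = π / ell D ^ 9 := by rw [alpha, bigP, Real.log_exp]
  have hαℓ : alpha D * ell D ≤ 1 := alpha_mul_ell_le_one hL2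
  have hαπ : alpha D ≤ π := by
    rw [hαeq]; exact div_le_self Real.pi_pos.le (one_le_pow₀ hL1)
  have hKα : K * alpha D < ell D := by
    calc K * alpha D ≤ K * π := mul_le_mul_of_nonneg_left hαπ hK0
      _ < ell D := by linarith
  -- `Im s > 0`
  have him3 : 3 * ell D ^ 519 ≤ s.im := by
    have ht0 : t0 D = ell D ^ 519 := rfl
    have hell1 : ell1 D = ell D ^ 405 := rfl
    have h405 : ell D ^ 405 ≤ ell D ^ 519 := pow_le_pow_right₀ hL1 (by norm_num)
    have h519' : (1 : ℝ) ≤ ell D ^ 519 := one_le_pow₀ hL1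
    have hπ519 : 3 * ell D ^ 519 ≤ π * ell D ^ 519 :=
      mul_le_mul_of_nonneg_right Real.pi_gt_three.le (by linarith)
    have h1 := (abs_lt.mp hs.2).1
    rw [hell1, ht0] at h1
    linarith
  have h519 : ell D ≤ ell D ^ 519 := le_self_pow₀ hL1 (by norm_num)
  have hs0 : 0 < s.im := by linarith
  -- `β₁ = ib₁`, `|b₁| ≤ Kα`
  set b₁ : ℝ := alpha D * (1 - 5 * c' * alpha D * ell D) with hb₁
  have hβ₁ : beta1 c' D = (b₁ : ℂ) * I := by simp only [beta1, hb₁]; push_cast; ring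
  have hcαℓ : |c' * alpha D * ell D| ≤ |c'| := by
    rw [mul_assoc, abs_mul]
    calc |c'| * |alpha D * ell D| ≤ |c'| * 1 := by
          refine mul_le_mul_of_nonneg_left ?_ (abs_nonneg _)
          rw [abs_of_nonneg (by positivity)]; exact hαℓ
      _ = |c'| := mul_one _
  have hb₁K : |b₁| ≤ K * alpha D := by
    rw [hb₁, abs_mul, abs_of_pos hα]
    have h1 : |1 - 5 * c' * alpha D * ell D| ≤ 1 + 5 * |c'| := by
      calc |1 - 5 * c' * alpha D * ell D| ≤ |(1 : ℝ)| + |5 * c' * alpha D * ell D| := abs_sub _ _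
        _ = 1 + 5 * |c' * alpha D * ell D| := by
            rw [abs_one, show 5 * c' * alpha D * ell D = 5 * (c' * alpha D * ell D) by ring,
              abs_mul, abs_of_pos (by norm_num : (0:ℝ) < 5)]
        _ ≤ 1 + 5 * |c'| := by linarith
    calc alpha D * |1 - 5 * c' * alpha D * ell D| ≤ alpha D * (1 + 5 * |c'|) :=
          mul_le_mul_of_nonneg_left h1 hα.le
      _ ≤ K * alpha D := by
          rw [hK, show 2 * (1 + 5 * |c'|) * alpha D
              = alpha D * (1 + 5 * |c'|) + alpha D * (1 + 5 * |c'|) by ring]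
          have h0 : 0 ≤ alpha D * (1 + 5 * |c'|) := by positivity
          linarith
  have hs1 : 0 < (s + beta1 c' D).im := by
    rw [hβ₁]; simp
    have := (abs_le.mp hb₁K).1
    linarith
  -- the relative shift and the exact ratio
  obtain ⟨ε, hZ₁, hε⟩ := h D χ hD₁ hq hχ x s hs b₁ hb₁K
  set u : ℂ := (((x.p : ℝ) * t0 D : ℝ) : ℂ) ^ (-((b₁ : ℂ) * I)) with hu
  have hZne : Zfac x.ψ s ≠ 0 := Zfac_ne_zero x.prim hs0
  have hW : gammaWeight17 c' D x.p (x.ψ (-1)) s = u * (1 + ε) := by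
    rw [← Zfac_shift_div_eq_gammaWeight17 c' x hs0 hs1, hβ₁, hZ₁]
    field_simp
  have hu1 : ‖u‖ = 1 := norm_pt0_cpow_neg_mul_I x hL0 b₁
  have hneg : -beta1 c' D = -((b₁ : ℂ) * I) := by rw [hβ₁]
  rw [hneg, hW, show u * (1 + ε) - u = u * ε by ring, norm_mul, hu1, one_mul]
  exact hε

end Size

end Literature.NumberTheory.LFunctions.Zhang2022.Typed.Section17
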